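import Summits.ValiantsHypothesis.ValiantsHypothesis.Theorems.DefinabilityGapPairWeightBound
import HarnessLib

/-!
# Definability gap, ROAD P: free cells on a sparse subfamily of a crowded line (N1 v2 (c))

The shared load of the WHOLE light part `L` of a crowded line is `≈ p N #L ≫ θ #L`, so
`weight_fewFree_le` is applied to a SPARSE subfamily `J ⊆ L`, `#J = s`, chosen by
`DefinabilityGapSparseSubfamily.exists_powersetCard_pairWeight_le` (averaging over
`L.powersetCard s`): its pair weight, hence its shared load, is at most
`sparseLoad p N n s = p N n · C(n−2, s−2) / C(n, s)` (`n = #L`; this is `≈ p N s² / n`).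

* `sparseLoad`, `sparseLoad_pos`; `htwo_mono`, `card_filter_free_mono` (subfamilies inherit the
  pair condition; free cells of `J` are free cells of `L`);
* **`exists_sparse_weight_fewFree_le`**: some `J ⊆ L` with `#J = s` has
  `W{#free(J) < θ s/2 − 2 (sparseLoad + t)} ≤ e^{−θ s/8} + e^{−t²/(2 (sparseLoad + t/3))}`,
  `θ = e^{−2pN}`;
* **`weight_fewFreeOn_le`**: hence `W{#free(L) < B}` obeys the same bound for every
  `B ≤ θ s/2 − 2 (sparseLoad + t)`.
-/

namespace Summit.ValiantsHypothesis.ValiantsHypothesis.Theorems.DefinabilityGapSparseFree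

open Finset Real Literature.Probability.Moments
open Summit.ValiantsHypothesis.ValiantsHypothesis.Theorems.DefinabilityGapSparseSubfamily
open Summit.ValiantsHypothesis.ValiantsHypothesis.Theorems.DefinabilityGapPrivateFree
open Summit.ValiantsHypothesis.ValiantsHypothesis.Theorems.DefinabilityGapActiveShared
open Summit.ValiantsHypothesis.ValiantsHypothesis.Theorems.DefinabilityGapPairWeightBound

variable {α β Γ : Type*} [DecidableEq α] [DecidableEq β]

/-! ## 1. The sparse load and two monotonicity facts -/

/-- The shared-load bound for an average `s`-subfamily of an `n`-family:
`p N n · C(n−2, s−2) / C(n, s)`. [this file] -/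
noncomputable def sparseLoad (p : ℝ) (N n s : ℕ) : ℝ :=
  p * N * n * ((n - 2).choose (s - 2) : ℝ) / (n.choose s : ℝ)

/-- `sparseLoad > 0` for `p > 0`, `N ≥ 1`, `2 ≤ s ≤ n`. [this file] -/
theorem sparseLoad_pos {p : ℝ} (hp : 0 < p) {N n s : ℕ} (hN : 0 < N) (hs : 2 ≤ s)
    (hsn : s ≤ n) : 0 < sparseLoad p N n s := by
  unfold sparseLoad
  have hN' : (0 : ℝ) < N := by exact_mod_cast hN
  have hn' : (0 : ℝ) < n := by exact_mod_cast (show 0 < n by omega)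
  have h1 : (0 : ℝ) < ((n - 2).choose (s - 2) : ℕ) := by
    exact_mod_cast Nat.choose_pos (by omega)
  have h2 : (0 : ℝ) < (n.choose s : ℕ) := by exact_mod_cast Nat.choose_pos hsn
  exact div_pos (mul_pos (mul_pos (mul_pos hp hN') hn') h1) h2

omit [DecidableEq α] in
/-- Subfamilies inherit the pair condition. [this file] -/
theorem htwo_mono (K : α → Finset β) {J L : Finset α} (hJL : J ⊆ L)
    (htwo : ∀ b, (L.filter fun j => b ∈ K j).card ≤ 2) (b : β) :
    (J.filter fun j => b ∈ K j).card ≤ 2 :=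
  (Finset.card_le_card (Finset.filter_subset_filter _ hJL)).trans (htwo b)

omit [DecidableEq α] [DecidableEq β] in
/-- Free cells of a subfamily are free cells of the family. [this file] -/
theorem card_filter_free_mono (K : α → Finset β) (act : α → β → Prop)
    [DecidablePred (free K act)] {J L : Finset α} (hJL : J ⊆ L) :
    (J.filter (free K act)).card ≤ (L.filter (free K act)).card :=
  Finset.card_le_card (Finset.filter_subset_filter _ hJL)

/-! ## 2. The crowded-line bound on a sparse subfamily -/

/-- The pair weight of the whole family: `pairWeight ω L ≤ p N #L`. [this file] -/
theorem pairWeight_omega_le_card {w : β → Γ → ℝ} {p : ℝ} (hp : 0 ≤ p)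
    (hwp : ∀ b a, w b a ≤ p) (K : α → Finset β) (τ : α → Γ) (L : Finset α)
    (htwo : ∀ b, (L.filter fun j => b ∈ K j).card ≤ 2) {N : ℕ}
    (hK : ∀ j ∈ L, (K j).card ≤ N) :
    pairWeight (omega w K τ) L ≤ p * N * L.card := by
  classical
  have h := pairWeight_omega_le hp hwp K τ L htwo
  have h3 : ∑ j ∈ L, ((K j).card : ℝ) ≤ N * L.card := by
    calc ∑ j ∈ L, ((K j).card : ℝ) ≤ ∑ j ∈ L, (N : ℝ) :=
          Finset.sum_le_sum fun j hj => by exact_mod_cast hK j hj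
      _ = N * L.card := by rw [Finset.sum_const, nsmul_eq_mul, mul_comm]
  calc pairWeight (omega w K τ) L ≤ p * ∑ j ∈ L, ((K j).card : ℝ) := h
    _ ≤ p * (N * L.card) := mul_le_mul_of_nonneg_left h3 hp
    _ = p * N * L.card := by ring

open scoped Classical in
/-- **Free cells on a sparse subfamily.**  Point weights `≤ p ≤ 1/2`, killer sets of size `≤ N`
on `L`, each killer in at most two of them, `2 ≤ s ≤ #L`: some `J ⊆ L` with `#J = s` satisfies
`W{#free(J) < e^{−2pN} s/2 − 2 (sparseLoad + t)} ≤ exp(−e^{−2pN} s/8) +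
exp(−t²/(2 (sparseLoad + t/3)))`. [this file] -/
theorem exists_sparse_weight_fewFree_le [Fintype β] [Fintype Γ] [DecidableEq Γ]
    {w : β → Γ → ℝ} (hw : ∀ b a, 0 ≤ w b a) (hw1 : ∀ b, ∑ a, w b a = 1) {p : ℝ}
    (hp0 : 0 < p) (hp : p ≤ 1 / 2) (hwp : ∀ b a, w b a ≤ p) (K : α → Finset β) (τ : α → Γ)
    (L : Finset α) (htwo : ∀ b, (L.filter fun j => b ∈ K j).card ≤ 2) {N : ℕ} (hN : 0 < N)
    (hK : ∀ j ∈ L, (K j).card ≤ N) {s : ℕ} (hs : 2 ≤ s) (hsL : s ≤ L.card) {t : ℝ}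
    (ht : 0 < t) :
    ∃ J ⊆ L, J.card = s ∧
      ∑ r ∈ (Finset.univ : Finset (β → Γ)).filter
          (fun r => ((J.filter (free K (fun j b => r b = τ j))).card : ℝ) <
            exp (-(2 * p * N)) * s / 2 - 2 * (sparseLoad p N L.card s + t)), prodWeight w r
        ≤ exp (-(exp (-(2 * p * N)) * s / 8)) +
          exp (-(t ^ 2 / (2 * (sparseLoad p N L.card s + 1 * t / 3)))) := by
  obtain ⟨J, hJmem, hJw⟩ := exists_powersetCard_pairWeight_le (omega w K τ) L hs hsL
  rw [Finset.mem_powersetCard] at hJmem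
  obtain ⟨hJL, hJcard⟩ := hJmem
  refine ⟨J, hJL, hJcard, ?_⟩
  have htwoJ : ∀ b, (J.filter fun j => b ∈ K j).card ≤ 2 := htwo_mono K hJL htwo
  have hKJ : ∀ j ∈ J, (K j).card ≤ N := fun j hj => hK j (hJL hj)
  have hchoose : (0 : ℝ) < (L.card.choose s : ℕ) := by exact_mod_cast Nat.choose_pos hsL
  have hPWL : pairWeight (omega w K τ) L ≤ p * N * L.card :=
    pairWeight_omega_le_card hp0.le hwp K τ L htwo hK
  have hA : sharedLoad w K τ J ≤ sparseLoad p N L.card s := by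
    have h1 := sharedLoad_le_pairWeight hw K τ J
    have h2 : pairWeight (omega w K τ) J ≤
        ((L.card - 2).choose (s - 2) : ℝ) * pairWeight (omega w K τ) L / (L.card.choose s : ℝ) := by
      rw [le_div_iff₀ hchoose]
      exact hJw
    have h3 : ((L.card - 2).choose (s - 2) : ℝ) * pairWeight (omega w K τ) L /
        (L.card.choose s : ℝ) ≤ sparseLoad p N L.card s := by
      unfold sparseLoad
      refine div_le_div_of_nonneg_right ?_ hchoose.le
      calc ((L.card - 2).choose (s - 2) : ℝ) * pairWeight (omega w K τ) L
          ≤ ((L.card - 2).choose (s - 2) : ℝ) * (p * N * L.card) :=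
            mul_le_mul_of_nonneg_left hPWL (by positivity)
        _ = p * N * L.card * ((L.card - 2).choose (s - 2) : ℝ) := by ring
    exact h1.trans (h2.trans h3)
  have hApos : 0 < sparseLoad p N L.card s := sparseLoad_pos hp0 hN hs hsL
  have key := weight_fewFree_le hw hw1 K τ J htwoJ (exp_pos _).le
    (fun j hj => theta_le_prod_priv hp0.le hp hwp K τ J hKJ hj) hA hApos ht
  rw [hJcard] at key
  exact key

open scoped Classical in
/-- **Few free cells on the whole line.**  Under the hypotheses of
`exists_sparse_weight_fewFree_le`, for every threshold `B ≤ e^{−2pN} s/2 − 2 (sparseLoad + t)`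
the assignments leaving fewer than `B` cells of `L` free weigh at most
`exp(−e^{−2pN} s/8) + exp(−t²/(2 (sparseLoad + t/3)))`. [this file] -/
theorem weight_fewFreeOn_le [Fintype β] [Fintype Γ] [DecidableEq Γ] {w : β → Γ → ℝ}
    (hw : ∀ b a, 0 ≤ w b a) (hw1 : ∀ b, ∑ a, w b a = 1) {p : ℝ} (hp0 : 0 < p)
    (hp : p ≤ 1 / 2) (hwp : ∀ b a, w b a ≤ p) (K : α → Finset β) (τ : α → Γ) (L : Finset α)
    (htwo : ∀ b, (L.filter fun j => b ∈ K j).card ≤ 2) {N : ℕ} (hN : 0 < N)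
    (hK : ∀ j ∈ L, (K j).card ≤ N) {s : ℕ} (hs : 2 ≤ s) (hsL : s ≤ L.card) {t : ℝ}
    (ht : 0 < t) {B : ℝ}
    (hB : B ≤ exp (-(2 * p * N)) * s / 2 - 2 * (sparseLoad p N L.card s + t)) :
    ∑ r ∈ (Finset.univ : Finset (β → Γ)).filter
        (fun r => ((L.filter (free K (fun j b => r b = τ j))).card : ℝ) < B), prodWeight w r
      ≤ exp (-(exp (-(2 * p * N)) * s / 8)) +
        exp (-(t ^ 2 / (2 * (sparseLoad p N L.card s + 1 * t / 3)))) := by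
  obtain ⟨J, hJL, -, hJ⟩ :=
    exists_sparse_weight_fewFree_le hw hw1 hp0 hp hwp K τ L htwo hN hK hs hsL ht
  refine le_trans (Finset.sum_le_sum_of_subset_of_nonneg ?_ fun r _ _ => prodWeight_nonneg hw r) hJ
  intro r hr
  rw [Finset.mem_filter] at hr ⊢
  refine ⟨Finset.mem_univ _, ?_⟩
  have hmono : ((J.filter (free K (fun j b => r b = τ j))).card : ℝ) ≤
      (L.filter (free K (fun j b => r b = τ j))).card := by
    exact_mod_cast card_filter_free_mono K (fun j b => r b = τ j) hJL
  linarith [hr.2]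

end Summit.ValiantsHypothesis.ValiantsHypothesis.Theorems.DefinabilityGapSparseFree
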